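import Summits.AtomisticToContinuum.HydrodynamicLimit.Theses.ImplosionDichotomy
import Literature.MathematicalPhysics.KineticTheory.HardSphereEulerProofs
import Literature.Analysis.FluidPDE.HardSphereAlexander

/-!
# `DenseExcursion ↔ ¬ DiluteSelfConsistency`, and `¬(DenseExcursion ∧ ¬PolynomialCompression)`

Negative-side structure of the route `ImplosionDichotomy` (crux `DenseExcursion`, stmt-AtomisticToContinuum-12586),
from the standing disprover's `Cruxes/DenseExcursion/Disproof.lean` §4–§5:

* `denseExcursion_iff_not_diluteSelfConsistency`: the rank-2 crux and the rank-3 crux (`DiluteSelfConsistency`,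
  stmt-3091, "the hidden PDE crux shared by 13 routes") are ONE decision problem — exactly one of them is a theorem.
  (`→`: a DE witness below the DSC threshold, shrunk under `1/2` so that a flow family exists by Alexander's theorem
  to instantiate DSC's `∀ Φ`, reaches the packing DSC forbids. `←`: pushing `¬` through DSC yields a tie through ONE
  flow family, which is admissibility because the `t = 0` tie is FLOW-INDEPENDENT: `Φ_0 = id` Liouville-a.e. and the
  local Gibbs law is absolutely continuous, `localGibbsLaw_preimage_flow_zero`.) A disproof of the crux is therefore a
  proof of stmt-3091, and conversely.
* `not_denseExcursion_and_not_polynomialCompression`: the crux implies the rank-4 crux `PolynomialCompression`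
  (`κ = 2`: packing `η` at `σ ≤ η` is density `≥ σ⁻²`; stated as `¬(DE ∧ ¬PC)`), so a refutation of
  `PolynomialCompression` refutes this crux too.
refuter-cdisprove-stmt-AtomisticToContinuum-12586-g2-0.
-/

noncomputable section

namespace Summit.AtomisticToContinuum.HydrodynamicLimit.Theorems

open MeasureTheory Filter Set Topology
open Literature.MathematicalPhysics.KineticTheory Literature.Analysis.FluidPDE
open Summit.AtomisticToContinuum.HydrodynamicLimit.Theses.ImplosionDichotomy

namespace DenseExcursionDichotomy

/-- **The `t = 0` tie is flow-independent**: the tie through one flow family `Φ` transfers to any other `Ψ`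
(both are the flow-free statement about `localGibbsMeasure`, by `localGibbsLaw_preimage_flow_zero`). [folklore] -/
theorem tendstoHydroFieldsAt_zero_transfer {σ : ℝ} {a₀ θ₀ : T3 → ℝ} {u₀ : T3 → V3}
    {ρ θ : ℝ → T3 → ℝ} {u : ℝ → T3 → V3}
    (Φ Ψ : (N : ℕ) → HardSphereFlow (Torus.geometry (Fin 3)) (hsDiameter σ N) (N + 1))
    (h : TendstoHydroFieldsAt (fun N => localGibbsLaw σ a₀ u₀ θ₀ N (Φ N)) Φ ρ u θ 0) :
    TendstoHydroFieldsAt (fun N => localGibbsLaw σ a₀ u₀ θ₀ N (Ψ N)) Ψ ρ u θ 0 := by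
  intro χ hχ δ hδ
  obtain ⟨h1, h2, h3⟩ := h χ hχ δ hδ
  have key : ∀ (Ξ : (N : ℕ) → HardSphereFlow (Torus.geometry (Fin 3)) (hsDiameter σ N) (N + 1))
      (N : ℕ) (p : Config (N + 1) (Fin 3) T3 → Prop),
      localGibbsLaw σ a₀ u₀ θ₀ N (Ξ N) {z | p ((Ξ N).flow 0 z)} = localGibbsMeasure σ a₀ u₀ θ₀ N {z | p z} :=
    fun Ξ N p => localGibbsLaw_preimage_flow_zero σ a₀ u₀ θ₀ N (Ξ N) {z | p z}
  have d1 : (fun N => localGibbsLaw σ a₀ u₀ θ₀ N (Φ N)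
      {z | δ < |empiricalDensityField ((Φ N).flow 0 z) χ - ∫ x, χ x * ρ 0 x|}) =
      fun N => localGibbsMeasure σ a₀ u₀ θ₀ N {z | δ < |empiricalDensityField z χ - ∫ x, χ x * ρ 0 x|} :=
    funext fun N => key Φ N fun z => δ < |empiricalDensityField z χ - ∫ x, χ x * ρ 0 x|
  have d2 : (fun N => localGibbsLaw σ a₀ u₀ θ₀ N (Ψ N)
      {z | δ < |empiricalDensityField ((Ψ N).flow 0 z) χ - ∫ x, χ x * ρ 0 x|}) =
      fun N => localGibbsMeasure σ a₀ u₀ θ₀ N {z | δ < |empiricalDensityField z χ - ∫ x, χ x * ρ 0 x|} :=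
    funext fun N => key Ψ N fun z => δ < |empiricalDensityField z χ - ∫ x, χ x * ρ 0 x|
  have m1 : (fun N => localGibbsLaw σ a₀ u₀ θ₀ N (Φ N)
      {z | δ < ‖empiricalMomentumField ((Φ N).flow 0 z) χ - ∫ x, (χ x * ρ 0 x) • u 0 x‖}) =
      fun N => localGibbsMeasure σ a₀ u₀ θ₀ N
        {z | δ < ‖empiricalMomentumField z χ - ∫ x, (χ x * ρ 0 x) • u 0 x‖} :=
    funext fun N => key Φ N fun z => δ < ‖empiricalMomentumField z χ - ∫ x, (χ x * ρ 0 x) • u 0 x‖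
  have m2 : (fun N => localGibbsLaw σ a₀ u₀ θ₀ N (Ψ N)
      {z | δ < ‖empiricalMomentumField ((Ψ N).flow 0 z) χ - ∫ x, (χ x * ρ 0 x) • u 0 x‖}) =
      fun N => localGibbsMeasure σ a₀ u₀ θ₀ N
        {z | δ < ‖empiricalMomentumField z χ - ∫ x, (χ x * ρ 0 x) • u 0 x‖} :=
    funext fun N => key Ψ N fun z => δ < ‖empiricalMomentumField z χ - ∫ x, (χ x * ρ 0 x) • u 0 x‖
  have e1 : (fun N => localGibbsLaw σ a₀ u₀ θ₀ N (Φ N)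
      {z | δ < |empiricalEnergyField ((Φ N).flow 0 z) χ -
        ∫ x, χ x * totalEnergyDensity (ρ 0 x) (u 0 x) (θ 0 x)|}) =
      fun N => localGibbsMeasure σ a₀ u₀ θ₀ N
        {z | δ < |empiricalEnergyField z χ - ∫ x, χ x * totalEnergyDensity (ρ 0 x) (u 0 x) (θ 0 x)|} :=
    funext fun N => key Φ N fun z =>
      δ < |empiricalEnergyField z χ - ∫ x, χ x * totalEnergyDensity (ρ 0 x) (u 0 x) (θ 0 x)|
  have e2 : (fun N => localGibbsLaw σ a₀ u₀ θ₀ N (Ψ N)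
      {z | δ < |empiricalEnergyField ((Ψ N).flow 0 z) χ -
        ∫ x, χ x * totalEnergyDensity (ρ 0 x) (u 0 x) (θ 0 x)|}) =
      fun N => localGibbsMeasure σ a₀ u₀ θ₀ N
        {z | δ < |empiricalEnergyField z χ - ∫ x, χ x * totalEnergyDensity (ρ 0 x) (u 0 x) (θ 0 x)|} :=
    funext fun N => key Ψ N fun z =>
      δ < |empiricalEnergyField z χ - ∫ x, χ x * totalEnergyDensity (ρ 0 x) (u 0 x) (θ 0 x)|
  rw [d1] at h1; rw [m1] at h2; rw [e1] at h3
  rw [d2, m2, e2]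
  exact ⟨h1, h2, h3⟩

/-- Flow families exist at every reduced density `0 < σ < 1/2` (Alexander's theorem on `𝕋³`). [cite: Alexander1975] -/
theorem flows_nonempty {σ : ℝ} (hσ : 0 < σ) (hσ2 : σ < 1 / 2) :
    Nonempty ((N : ℕ) → HardSphereFlow (Torus.geometry (Fin 3)) (hsDiameter σ N) (N + 1)) :=
  ⟨fun N => Classical.choice (HardSphereFlow.nonempty_torus_holds (d := Fin 3)
    (hsDiameter_pos hσ N) ((hsDiameter_le hσ.le N).trans_lt (hσ2.trans_eq (by norm_num))) (N + 1))⟩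

end DenseExcursionDichotomy

open DenseExcursionDichotomy

/-- The two cruxes are INCOMPATIBLE: `¬ (DenseExcursion ∧ DiluteSelfConsistency)` (a DE witness below the DSC
threshold, shrunk under `1/2` so that a flow family exists, reaches the packing DSC forbids). [folklore] -/
theorem not_denseExcursion_and_diluteSelfConsistency : ¬ (DenseExcursion ∧ DiluteSelfConsistency) := by
  rintro ⟨⟨η, hη, a₀, θ₀, u₀, ha, hθ, hu, ha0, hθ0, H⟩, hD⟩
  obtain ⟨σ₀, hσ₀, D⟩ := hD η hη a₀ θ₀ u₀ ha hθ hu ha0 hθ0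
  obtain ⟨σ, hσ, hσlt, T, ρ, θ, u, hE, hA, t, ht, x, hx⟩ := H (min σ₀ (1 / 2)) (lt_min hσ₀ (by norm_num))
  obtain ⟨Φ⟩ := flows_nonempty hσ (lt_of_lt_of_le hσlt (min_le_right _ _))
  exact absurd (D σ hσ (lt_of_lt_of_le hσlt (min_le_left _ _)) T ρ θ u hE Φ (hA Φ) t ht x) (not_lt.2 hx)

/-- **THE DICHOTOMY**: `DenseExcursion ↔ ¬ DiluteSelfConsistency` — the rank-2 and rank-3 cruxes of
`ImplosionDichotomy` are one decision problem (`←`: the tie through the one flow family produced by the negation is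
the tie through every flow family). [folklore] -/
theorem denseExcursion_iff_not_diluteSelfConsistency : DenseExcursion ↔ ¬ DiluteSelfConsistency := by
  refine ⟨fun hDE hD => not_denseExcursion_and_diluteSelfConsistency ⟨hDE, hD⟩, fun h => ?_⟩
  unfold DiluteSelfConsistency at h
  push Not at h
  obtain ⟨η, hη, a₀, θ₀, u₀, ha, hθ, hu, ha0, hθ0, H⟩ := h
  refine ⟨η, hη, a₀, θ₀, u₀, ha, hθ, hu, ha0, hθ0, fun σ₀ hσ₀ => ?_⟩
  obtain ⟨σ, hσ, hσlt, T, ρ, θ, u, hE, Φ, hΦ, t, ht, x, hx⟩ := H σ₀ hσ₀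
  exact ⟨σ, hσ, hσlt, T, ρ, θ, u, hE, fun Ψ => tendstoHydroFieldsAt_zero_transfer Φ Ψ hΦ, t, ht, x, hx⟩

/-- Contrapositive bookkeeping: refuting the crux IS proving stmt-3091, and conversely. [folklore] -/
theorem not_denseExcursion_iff_diluteSelfConsistency : ¬ DenseExcursion ↔ DiluteSelfConsistency := by
  rw [denseExcursion_iff_not_diluteSelfConsistency, not_not]

/-- **LADDER** (stated negatively): the crux cannot hold while the rank-4 crux `PolynomialCompression` fails —
packing `η` at `σ ≤ η` is density `≥ σ⁻²` (`κ = 2`). So a refutation of `PolynomialCompression` refutes this crux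
(and proves `DiluteSelfConsistency`). [folklore] -/
theorem not_denseExcursion_and_not_polynomialCompression : ¬ (DenseExcursion ∧ ¬ PolynomialCompression) := by
  rintro ⟨⟨η, hη, a₀, θ₀, u₀, ha, hθ, hu, ha0, hθ0, H⟩, hP⟩
  refine hP ⟨2, two_pos, a₀, θ₀, u₀, ha, hθ, hu, ha0, hθ0, fun σ₀ hσ₀ => ?_⟩
  obtain ⟨σ, hσ, hσlt, T, ρ, θ, u, hE, hA, t, ht, x, hx⟩ := H (min σ₀ η) (lt_min hσ₀ hη)
  refine ⟨σ, hσ, lt_of_lt_of_le hσlt (min_le_left _ _), T, ρ, θ, u, hE, hA, t, ht, x, ?_⟩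
  have hση : σ ≤ η := (lt_of_lt_of_le hσlt (min_le_right _ _)).le
  have hσ3 : 0 < σ ^ 3 := pow_pos hσ 3
  have hrpow : σ ^ (-(2 : ℝ)) = (σ ^ 2)⁻¹ := by
    rw [Real.rpow_neg hσ.le, Real.rpow_two]
  rw [hrpow, inv_le_iff_one_le_mul₀ (pow_pos hσ 2)]
  have h1 : σ * 1 ≤ σ * (ρ t x * σ ^ 2) := by nlinarith
  exact le_of_mul_le_mul_left h1 hσ

end Summit.AtomisticToContinuum.HydrodynamicLimit.Theorems

end
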